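import Summits.CriticalPhenomena.PercolationContinuityZ3.Theorems.PercNearOneGluingNoHeavyQuantSymTripleTrueFloor
import Summits.CriticalPhenomena.PercolationContinuityZ3.Theorems.PercNearOneGluingNoHeavyQuantGluedForestSDEC
import HarnessLib

/-!
# QUANT lane R8, T-DEC: THE SYMMETRIC FOREST OF EVERY WIDTH AT ITS TRUE FLOOR — `k` identical composite siblings with root gate `q ≤ 1/2`
# are SDEC given the oracle, by an explicit `k`-component re-hung certificate (arm-1 gen 53, architect)

builds on p205010 (kernel theorem, internal audit signed; external expert review pending)

Support file (`--supports stmt-CriticalPhenomena-4575`), QUANT lane seat prim-quant-arm-1 (gen 53, architect); memo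
`run/shared/lean/prim/quant/prim-quant-arm-1-g53/ARCH-G53.md` §2d.  Theorems only, standard axioms, no sorries.  Sequel of ✓ `…QuantSymTripleTrueFloor`
(the width-3 case) with census-1 g25's generating polynomials (`…QuantURPMLaw`).

THE CERTIFICATE (every `k = m+2 ≥ 2`, `2q ≤ 1`; `u = 1 − q + q s` the root-count pgf of one sibling):
  `Σ_{j=0}^{m} q^j (1−q)·u^{m−j}·(u − q + q s^{j+1}) + q^{m+1}·(1 − q + q s^{m+2}) = u^{m+2}`   (`symForest_pgf`, induction on `m`),
read as: `flaw (k copies of t) = Σ_{j ≤ m} q^j(1−q)·C_j + q^{m+1}·C_{m+1}` with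
  `C_j` = `m − j` plain siblings ∗ ONE sibling with root gate `2q` under whose root the MERGED group of `j` opened blocks hangs at edge `1/2`
  (one block absent), `C_{m+1}` = the merged group of all `k` blocks under one root gate `q` (`flaw_symForest_eq_mix`).
Every component is tree-built AT THE FOREST'S OWN FLOOR `q·x₁` (effective opennesses `q`, `2q`, `2q·½ = q`) with at most `(m+1)(t.n+1) <
fgates` nontrivial gates and has mean exactly `k·q·m`, so **`sdec_symForest_trueFloor`**: `Sib.TreeOK x t`, `2·t.q ≤ 1`, `2 ≤ k`, the oracle below
`fgates (List.replicate k t)` ⟹ `SDEC x (ftop (List.replicate k t)) (flaw (List.replicate k t))`.  The symmetric locus of the generic core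
("comparable gates", no heavy sibling) is therefore NOT an obstruction at any width for `q ≤ 1/2`; for `q > 1/2` see `…QuantSymTriple` (slack) and
memo §2c (no root-level true-floor certificate for width 3).
* `symForest_pgf`; `fgates_replicate` (`ftop_replicate`, `fmean_replicate` are the lane's `…QuantGluedForestSDEC`); `lawPoly_fsum`, `lawPoly_add_smul`; `treeBuiltN_flaw_replicate`
  (the plain sub-forest of `i` copies at floor `q x₁` with `i(n+1)` gates), `treeBuiltN_opow` (the merged group of `i` opened blocks: `flaw` of `i`
  copies of the OPENED sibling `regate t 1`, `i·n` gates), `hung_cert`; `flaw_symForest_eq_mix`; `sdec_symForest_trueFloor`.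

HONEST STATUS.  Symmetric forests with `q > 1/2` at the true floor, non-identical groups without a heavy sibling, `SiblingStep`, `GateStepN`,
`LightResidDECOracle`, `FarTreeRow` remain OPEN; RATE class (log\*) / honest sentence of `run/shared/lean/prim/quant/README.md` unchanged.  [this work].
Nothing here is cited as a published result.  The gluing rows served [cite: KozmaNitzan2024, Conjecture 3 (p. 15)]; product measure
[cite: Grimmett1999, §1.3 p. 10].
-/

noncomputable section

open scoped BigOperators
open Polynomial

namespace Summit.CriticalPhenomena.PercolationContinuityZ3.Theorems
namespace Quant
namespace LawDec

open Finset

/-! ### The generating-function identity -/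

/-- **the certificate identity** (any commutative ring): with `u = 1 − q + q s`,
`Σ_{j ≤ m} q^j(1−q)·u^{m−j}·(u − q + q s^{j+1}) + q^{m+1}(1 − q + q s^{m+2}) = u^{m+2}`. [this work] -/
theorem symForest_pgf {R : Type*} [CommRing R] (q s : R) (m : ℕ) :
    (∑ j ∈ Finset.range (m + 1), q ^ j * (1 - q) * (1 - q + q * s) ^ (m - j) * ((1 - q + q * s) - q + q * s ^ (j + 1)))
      + q ^ (m + 1) * (1 - q + q * s ^ (m + 2)) = (1 - q + q * s) ^ (m + 2) := by
  induction m with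
  | zero =>
    rw [Finset.sum_range_one]
    ring
  | succ m ih =>
    rw [Finset.sum_range_succ, Nat.sub_self, pow_zero]
    have e : ∑ j ∈ Finset.range (m + 1), q ^ j * (1 - q) * (1 - q + q * s) ^ (m + 1 - j) * ((1 - q + q * s) - q + q * s ^ (j + 1))
        = (1 - q + q * s) * ∑ j ∈ Finset.range (m + 1), q ^ j * (1 - q) * (1 - q + q * s) ^ (m - j) * ((1 - q + q * s) - q + q * s ^ (j + 1)) := by
      rw [Finset.mul_sum]
      refine Finset.sum_congr rfl fun j hj => ?_
      rw [Finset.mem_range] at hj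
      rw [show m + 1 - j = m - j + 1 by omega, pow_succ]
      ring
    have ih' : ∑ j ∈ Finset.range (m + 1), q ^ j * (1 - q) * (1 - q + q * s) ^ (m - j) * ((1 - q + q * s) - q + q * s ^ (j + 1))
        = (1 - q + q * s) ^ (m + 2) - q ^ (m + 1) * (1 - q + q * s ^ (m + 2)) := by rw [← ih]; ring
    rw [e, ih']
    ring

/-! ### Lists of identical siblings -/

/-- `fgates` of `i` copies. [this work] -/
theorem fgates_replicate (t : Sib) : ∀ i : ℕ, fgates (List.replicate i t) = i * (t.n + 1)
  | 0 => by simp [fgates]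
  | i + 1 => by rw [List.replicate_succ, show fgates (t :: List.replicate i t) = fgates (List.replicate i t) + (t.n + 1) from rfl, fgates_replicate t i]; ring

/-- linearity of `lawPoly` over finite mixtures. [this work] -/
theorem lawPoly_fsum {ι : Type*} (s : Finset ι) (M : ℕ) (c : ι → ℝ) (μ : ι → ℕ → ℝ) :
    lawPoly M (fun k => ∑ i ∈ s, c i * μ i k) = ∑ i ∈ s, C (c i) * lawPoly M (μ i) := by
  unfold lawPoly
  simp only [map_sum, map_mul, Finset.sum_mul, Finset.mul_sum, mul_assoc]
  rw [Finset.sum_comm]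

/-- `lawPoly` of `μ + b·ν`. [this work] -/
theorem lawPoly_add_smul (M : ℕ) (b : ℝ) (μ ν : ℕ → ℝ) :
    lawPoly M (fun k => μ k + b * ν k) = lawPoly M μ + C b * lawPoly M ν := by
  unfold lawPoly
  simp only [map_add, map_mul, add_mul, Finset.sum_add_distrib, Finset.mul_sum, mul_assoc]

/-- the generating polynomial of `i` copies. [this work] -/
theorem lawPoly_flaw_replicate (t : Sib) (i : ℕ) :
    lawPoly (ftop (List.replicate i t)) (flaw (List.replicate i t)) = (C t.q * lawPoly t.M t.ρ + C (1 - t.q)) ^ i := by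
  rw [lawPoly_flaw, List.map_replicate, List.prod_replicate]
  rfl

/-- the generating polynomial of the merged group of `i` OPENED copies (`regate t 1`): `P^i`. [this work] -/
theorem lawPoly_flaw_replicate_open (t : Sib) (i : ℕ) :
    lawPoly (ftop (List.replicate i (regate t 1))) (flaw (List.replicate i (regate t 1))) = (lawPoly t.M t.ρ) ^ i := by
  rw [lawPoly_flaw, List.map_replicate, List.prod_replicate]
  show (C (1 : ℝ) * lawPoly t.M t.ρ + C (1 - 1)) ^ i = _
  rw [map_one, one_mul, sub_self, map_zero, add_zero]

/-- **the plain sub-forest of `i` copies is tree-built at the true floor `q·x₁` with `i·(n+1)` gates.** [this work] -/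
theorem treeBuiltN_flaw_replicate {x : ℝ} (t : Sib) (ht : t.TreeOK x) (i : ℕ) :
    TreeBuiltN (t.q * t.x₁) (i * (t.n + 1)) (ftop (List.replicate i t)) (flaw (List.replicate i t)) := by
  obtain ⟨hq0, hq1, _, hT, hnp⟩ := ht
  obtain ⟨hx₁0, hx₁1, _, _, _, _⟩ := hT.lawFacts
  have hy0 : 0 < t.q * t.x₁ := mul_pos hq0 hx₁0
  have hy1 : t.q * t.x₁ < 1 := mul_lt_one_aux hq1.le hx₁0.le hx₁1
  have hmem : ∀ s ∈ List.replicate i t, s.TreeOK (t.q * t.x₁) := by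
    intro s hs
    rw [List.eq_of_mem_replicate hs]
    exact ⟨hq0, hq1, le_rfl, hT, hnp⟩
  have h := flaw_treeBuiltN hy0 hy1 (List.replicate i t) hmem
  rwa [fgates_replicate] at h

/-- **the merged group of `i` opened copies is tree-built at `x₁` with `i·n` gates.** [this work] -/
theorem treeBuiltN_opow {x : ℝ} (t : Sib) (ht : t.TreeOK x) : ∀ i : ℕ,
    TreeBuiltN t.x₁ (i * t.n) (ftop (List.replicate i (regate t 1))) (flaw (List.replicate i (regate t 1)))
  | 0 => by
    obtain ⟨_, _, _, hT, _⟩ := ht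
    obtain ⟨hx₁0, hx₁1, _, _, _, _⟩ := hT.lawFacts
    simpa [ftop, flaw] using TreeBuiltN.nil t.x₁ hx₁0 hx₁1
  | i + 1 => by
    have hT : TreeBuiltN t.x₁ t.n t.M t.ρ := ht.2.2.2.1
    have ih := treeBuiltN_opow t ht i
    rw [List.replicate_succ]
    show TreeBuiltN t.x₁ ((i + 1) * t.n) (ftop (List.replicate i (regate t 1)) + t.M)
      (lconv (ftop (List.replicate i (regate t 1))) t.M (flaw (List.replicate i (regate t 1))) (gate t.ρ 1))
    rw [gate_one, show (i + 1) * t.n = i * t.n + t.n by ring]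
    exact TreeBuiltN.conv ih hT

/-- the hung part `gate_{1/2}(merged group of j opened copies)`: tree-built at `x₁/2` with at most `j·(n+1)` gates (for `j = 0` it is `δ₀`).
[this work] -/
theorem hung_cert {x : ℝ} (t : Sib) (ht : t.TreeOK x) (j : ℕ) :
    ∃ c : ℕ, c ≤ j * (t.n + 1) ∧ TreeBuiltN (1 / 2 * t.x₁) c (ftop (List.replicate j (regate t 1)))
      (gate (flaw (List.replicate j (regate t 1))) (1 / 2)) := by
  obtain ⟨_, _, _, hT, _⟩ := id ht
  obtain ⟨hx₁0, hx₁1, _, _, _, _⟩ := hT.lawFacts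
  rcases Nat.eq_zero_or_pos j with hj | hj
  · subst hj
    refine ⟨0, Nat.zero_le _, ?_⟩
    have e : gate (flaw (List.replicate 0 (regate t 1))) (1 / 2) = fun h => if h = 0 then (1 : ℝ) else 0 := by
      funext h
      simp only [List.replicate, flaw, gate_apply]
      split_ifs <;> norm_num
    rw [e]
    exact TreeBuiltN.nil _ (by positivity) (by linarith)
  · refine ⟨j * t.n + 1, by nlinarith, ?_⟩
    have h := TreeBuiltN.gate (1 / 2 : ℝ) (by norm_num) (by norm_num) (treeBuiltN_opow t ht j)
    exact h

/-! ### Top / gate-count arithmetic for the components -/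

/-- `(m − j)·M + (M + j·M) = (m+1)·M` for `j ≤ m`. [this work] -/
theorem tops_eq (M m j : ℕ) (hj : j ≤ m) : (m - j) * M + (M + j * M) = (m + 1) * M := by
  rw [show (m - j) * M + (M + j * M) = ((m - j) + j) * M + M by ring, Nat.sub_add_cancel hj]; ring

/-- geometric weights: `Σ_{j<n} q^j (1−q) = 1 − q^n`. [this work] -/
theorem geom_weights (q : ℝ) : ∀ n : ℕ, ∑ j ∈ Finset.range n, q ^ j * (1 - q) = 1 - q ^ n
  | 0 => by simp
  | n + 1 => by rw [Finset.sum_range_succ, geom_weights q n]; ring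

/-! ### The law identity -/

/-- **THE CERTIFICATE AS AN IDENTITY OF COUNT LAWS** (`2e = 1`): `flaw (m+2 copies of t)` is the explicit mixture of the `m+2` component laws.
[this work] -/
theorem flaw_symForest_eq_mix (t : Sib) (m : ℕ) (e : ℝ) (he : 2 * e = 1) :
    flaw (List.replicate (m + 2) t) = fun h =>
      (∑ j ∈ Finset.range (m + 1), (t.q ^ j * (1 - t.q)) *
        lconv (ftop (List.replicate (m - j) t)) (t.M + ftop (List.replicate j (regate t 1)))
          (flaw (List.replicate (m - j) t))
          (gate (lconv t.M (ftop (List.replicate j (regate t 1))) t.ρ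
            (gate (flaw (List.replicate j (regate t 1))) e)) (2 * t.q)) h)
      + t.q ^ (m + 1) * gate (flaw (List.replicate (m + 2) (regate t 1))) t.q h := by
  have hT1 : ∀ i, ftop (List.replicate i (regate t 1)) = i * t.M := fun i => ftop_replicate i (regate t 1)
  have hT0 : ∀ i, ftop (List.replicate i t) = i * t.M := fun i => ftop_replicate i t
  apply eq_of_lawPoly_eq (ftop (List.replicate (m + 2) t))
  · exact flaw_eq_zero_of_lt _
  · intro h hh
    rw [hT0] at hh
    have hz : ∀ j ∈ Finset.range (m + 1), (t.q ^ j * (1 - t.q)) *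
        lconv (ftop (List.replicate (m - j) t)) (t.M + ftop (List.replicate j (regate t 1)))
          (flaw (List.replicate (m - j) t))
          (gate (lconv t.M (ftop (List.replicate j (regate t 1))) t.ρ
            (gate (flaw (List.replicate j (regate t 1))) e)) (2 * t.q)) h = 0 := by
      intro j hj
      rw [Finset.mem_range] at hj
      rw [lconv_eq_zero _ _ _ _ h (by
        rw [hT0, hT1, tops_eq t.M m j (by omega)]
        exact lt_of_le_of_lt (Nat.mul_le_mul_right _ (by omega)) hh), mul_zero]
    rw [Finset.sum_eq_zero hz, gate_eq_zero_above _ _ _ (flaw_eq_zero_of_lt _) h (by rw [hT1]; exact hh)]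
    ring
  -- generating polynomials
  rw [lawPoly_flaw_replicate, lawPoly_add_smul, lawPoly_fsum]
  have hcomp : ∀ j ∈ Finset.range (m + 1), lawPoly (ftop (List.replicate (m + 2) t))
      (lconv (ftop (List.replicate (m - j) t)) (t.M + ftop (List.replicate j (regate t 1)))
          (flaw (List.replicate (m - j) t))
          (gate (lconv t.M (ftop (List.replicate j (regate t 1))) t.ρ
            (gate (flaw (List.replicate j (regate t 1))) e)) (2 * t.q)))
      = (C t.q * lawPoly t.M t.ρ + C (1 - t.q)) ^ (m - j) *
          (C (2 * t.q) * (lawPoly t.M t.ρ * (C e * lawPoly t.M t.ρ ^ j + C (1 - e))) + C (1 - 2 * t.q)) := by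
    intro j hj
    rw [Finset.mem_range] at hj
    rw [lawPoly_top_of_le (ftop (List.replicate (m - j) t) + (t.M + ftop (List.replicate j (regate t 1))))
        (ftop (List.replicate (m + 2) t)) _ (by rw [hT0, hT0, hT1, tops_eq t.M m j (by omega)]; exact Nat.mul_le_mul_right _ (by omega))
        (fun k hk => lconv_eq_zero _ _ _ _ k hk),
      lawPoly_lconv, lawPoly_flaw_replicate, lawPoly_gate, lawPoly_lconv, lawPoly_gate, lawPoly_flaw_replicate_open]
  have hlast : lawPoly (ftop (List.replicate (m + 2) t)) (gate (flaw (List.replicate (m + 2) (regate t 1))) t.q)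
      = C t.q * lawPoly t.M t.ρ ^ (m + 2) + C (1 - t.q) := by
    rw [lawPoly_top_of_le (ftop (List.replicate (m + 2) (regate t 1))) (ftop (List.replicate (m + 2) t)) _ (by rw [hT0, hT1])
        (gate_eq_zero_above _ _ _ (flaw_eq_zero_of_lt _)), lawPoly_gate, lawPoly_flaw_replicate_open]
  rw [Finset.sum_congr rfl (fun j hj => by rw [hcomp j hj]), hlast]
  set P : ℝ[X] := lawPoly t.M t.ρ
  have heP := congrArg Polynomial.C he
  simp only [map_mul, map_one, map_ofNat] at heP
  have key : ∀ j ∈ Finset.range (m + 1), C (t.q ^ j * (1 - t.q)) * ((C t.q * P + C (1 - t.q)) ^ (m - j) *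
      (C (2 * t.q) * (P * (C e * P ^ j + C (1 - e))) + C (1 - 2 * t.q)))
      = (C t.q) ^ j * (1 - C t.q) * (1 - C t.q + C t.q * P) ^ (m - j) * ((1 - C t.q + C t.q * P) - C t.q + C t.q * P ^ (j + 1)) := by
    intro j _
    simp only [map_mul, map_pow, map_sub, map_one, map_ofNat]
    have hU : C t.q * P + (1 - C t.q) = 1 - C t.q + C t.q * P := by ring
    rw [hU]
    linear_combination (C t.q ^ j * (1 - C t.q) * (1 - C t.q + C t.q * P) ^ (m - j) * C t.q * (P ^ (j + 1) - P)) * heP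
  rw [Finset.sum_congr rfl key]
  have hfin := symForest_pgf (C t.q) P m
  simp only [map_pow, map_sub, map_one]
  have hU : C t.q * P + (1 - C t.q) = 1 - C t.q + C t.q * P := by ring
  rw [hU]
  linear_combination (-1 : ℝ[X]) * hfin

/-! ### The theorem -/

/-- **THE SYMMETRIC FOREST IS SDEC AT ITS TRUE FLOOR (every width, `q ≤ 1/2`).**  Floor `0 < x < 1`, a tree-built composite sibling `t` with
`2·t.q ≤ 1`, any `m`, and the oracle "every tree-built law with fewer than `fgates` of the forest of `m+2` copies of `t` is SDEC" ⟹ the forest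
of `m+2` copies of `t` is SDEC at `x`. [this work] -/
theorem sdec_symForest_trueFloor {x : ℝ} (hx0 : 0 < x) (hx1 : x < 1) (t : Sib) (ht : t.TreeOK x) (hq2 : 2 * t.q ≤ 1) (m : ℕ)
    (hO : ∀ (x' : ℝ) (n' M' : ℕ) (μ' : ℕ → ℝ), n' < fgates (List.replicate (m + 2) t) → TreeBuiltN x' n' M' μ' → SDEC x' M' μ') :
    SDEC x (ftop (List.replicate (m + 2) t)) (flaw (List.replicate (m + 2) t)) := by
  classical
  intro a ha0 ha1 J hJ
  have ht' := ht
  obtain ⟨hq0, hq1, hxq, hT, _⟩ := ht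
  obtain ⟨hx₁0, hx₁1, ρ0, ρM, ρ1, ρta⟩ := hT.lawFacts
  have hT1 : ∀ i, ftop (List.replicate i (regate t 1)) = i * t.M := fun i => ftop_replicate i (regate t 1)
  have hT0 : ∀ i, ftop (List.replicate i t) = i * t.M := fun i => ftop_replicate i t
  have hfg : fgates (List.replicate (m + 2) t) = (m + 2) * (t.n + 1) := fgates_replicate t (m + 2)
  have h2q0 : 0 < 2 * t.q := by linarith
  set z : ℝ := a * x with hzdef
  have hz0 : 0 < z := mul_pos ha0 hx0
  have hz1 : z < 1 := by rw [hzdef]; exact mul_lt_one_aux ha1 hx0.le hx1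
  set mt : ℝ := t.mean with hmtdef
  have hmean : ∑ h ∈ Finset.range (t.M + 1), (h : ℝ) * t.ρ h = mt := rfl
  have hrq : (regate t 1).q = 1 := rfl
  have hrm : (regate t 1).mean = mt := rfl
  -- the common floor `q·x₁`
  set y : ℝ := t.q * t.x₁ with hydef
  have hy0 : 0 < y := mul_pos hq0 hx₁0
  have hy1 : y < 1 := mul_lt_one_aux hq1.le hx₁0.le hx₁1
  have hzy : z ≤ a * y := by rw [hzdef]; exact mul_le_mul_of_nonneg_left hxq ha0.le
  have hay : a * y < 1 := mul_lt_one_aux ha1 hy0.le hy1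
  have hy2 : y / (2 * t.q) = 1 / 2 * t.x₁ := by rw [hydef]; field_simp
  -- law facts of the sibling and of the opened sibling
  have hLt : ∀ s ∈ List.replicate (m + 2) t, s.LawOK := by
    intro s hs; rw [List.eq_of_mem_replicate hs]; exact ⟨hq0, hq1, ρ0, ρM, ρ1⟩
  have hLi : ∀ i, ∀ s ∈ List.replicate i t, s.LawOK := by
    intro i s hs; rw [List.eq_of_mem_replicate hs]; exact ⟨hq0, hq1, ρ0, ρM, ρ1⟩
  have hL1 : ∀ i, ∀ s ∈ List.replicate i (regate t 1),
      0 ≤ s.q ∧ s.q ≤ 1 ∧ (∀ h, 0 ≤ s.ρ h) ∧ (∀ h, s.M < h → s.ρ h = 0) ∧ ∑ h ∈ Finset.range (s.M + 1), s.ρ h = 1 := by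
    intro i s hs; rw [List.eq_of_mem_replicate hs]; exact ⟨zero_le_one, le_rfl, ρ0, ρM, ρ1⟩
  -- the common target
  set TE : ℝ := a * (((m : ℝ) + 2) * (t.q * mt)) with hTEdef
  -- components and weights
  let comp : ℕ → ℕ → ℝ := fun j =>
    if j ≤ m then
      lconv (ftop (List.replicate (m - j) t)) (t.M + ftop (List.replicate j (regate t 1)))
        (flaw (List.replicate (m - j) t))
        (gate (lconv t.M (ftop (List.replicate j (regate t 1))) t.ρ
          (gate (flaw (List.replicate j (regate t 1))) (1 / 2))) (2 * t.q))
    else gate (flaw (List.replicate (m + 2) (regate t 1))) t.q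
  let w : ℕ → ℝ := fun j => if j ≤ m then t.q ^ j * (1 - t.q) else t.q ^ (m + 1)
  have hw0 : ∀ j ∈ Finset.range (m + 2), 0 ≤ w j := by
    intro j _
    by_cases hjm : j ≤ m
    · simp only [w, if_pos hjm]; exact mul_nonneg (pow_nonneg hq0.le _) (by linarith)
    · simp only [w, if_neg hjm]; exact pow_nonneg hq0.le _
  have hw1 : ∑ j ∈ Finset.range (m + 2), w j = 1 := by
    rw [Finset.sum_range_succ]
    have e1 : ∑ j ∈ Finset.range (m + 1), w j = ∑ j ∈ Finset.range (m + 1), t.q ^ j * (1 - t.q) :=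
      Finset.sum_congr rfl fun j hj => by rw [Finset.mem_range] at hj; simp only [w, if_pos (show j ≤ m by omega)]
    rw [e1, geom_weights]
    simp only [w, if_neg (show ¬ (m + 1 ≤ m) by omega)]
    ring
  -- every component: ONE oracle call at the floor `q·x₁`, gated mean `TE`
  have hdec : ∀ j ∈ Finset.range (m + 2), 0 < w j →
      DECAtT z TE J (ftop (List.replicate (m + 2) t)) (gate (comp j) a) := by
    intro j hj _
    rw [Finset.mem_range] at hj
    by_cases hjm : j ≤ m
    · simp only [comp, if_pos hjm]
      -- the hung part and the doubled sibling
      obtain ⟨c, hc, hH⟩ := hung_cert t ht' j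
      have hHj : TreeBuiltN (1 / 2 * t.x₁) (t.n + c) (t.M + ftop (List.replicate j (regate t 1)))
          (lconv t.M (ftop (List.replicate j (regate t 1))) t.ρ (gate (flaw (List.replicate j (regate t 1))) (1 / 2))) :=
        TreeBuiltN.conv (TreeBuiltN.mono hT (by positivity) (by nlinarith)) hH
      obtain ⟨c', hc', hG⟩ := treeBuiltN_gate_le y (2 * t.q) (t.n + c) _ _ h2q0 hq2 (by rw [hy2]; exact hHj)
      have hF : TreeBuiltN y ((m - j) * (t.n + 1)) (ftop (List.replicate (m - j) t)) (flaw (List.replicate (m - j) t)) :=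
        treeBuiltN_flaw_replicate t ht' (m - j)
      have hC := TreeBuiltN.conv hF hG
      have hcount : (m - j) * (t.n + 1) + c' < fgates (List.replicate (m + 2) t) := by
        rw [hfg]
        have e1 : (m - j) * (t.n + 1) + j * (t.n + 1) = m * (t.n + 1) := by rw [← Nat.add_mul, Nat.sub_add_cancel hjm]
        have e2 : (m + 2) * (t.n + 1) = m * (t.n + 1) + (t.n + 1) + (t.n + 1) := by ring
        have e3 : j * (t.n + 1) = j * t.n + j := by ring
        rw [e2, ← e1]
        omega
      have hS := hO y _ _ _ hcount hC
      obtain ⟨_, _, F0, FM, F1, Fta⟩ := hC.lawFacts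
      -- the mean
      obtain ⟨_, _, f1, fmn⟩ := flaw_facts (List.replicate (m - j) t) (hLi (m - j))
      obtain ⟨_, _, o1, omn⟩ := flaw_facts_weak (List.replicate j (regate t 1)) (hL1 j)
      obtain ⟨g0, gM, g1⟩ := gate_laws (ftop (List.replicate j (regate t 1))) _ (1 / 2) (by norm_num) (by norm_num)
        (flaw_facts_weak (List.replicate j (regate t 1)) (hL1 j)).1 (flaw_eq_zero_of_lt _) o1
      have hHmass := sum_lconv t.M (ftop (List.replicate j (regate t 1))) t.ρ _ ρ1 g1
      obtain ⟨_, _, G1⟩ := gate_laws (t.M + ftop (List.replicate j (regate t 1))) _ (2 * t.q) h2q0.le hq2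
        (lconv_nonneg _ _ _ _ ρ0 g0) (fun k hk => lconv_eq_zero _ _ _ _ k hk) hHmass
      have hCmean : ∑ h ∈ Finset.range (ftop (List.replicate (m - j) t) + (t.M + ftop (List.replicate j (regate t 1))) + 1), (h : ℝ) *
          lconv (ftop (List.replicate (m - j) t)) (t.M + ftop (List.replicate j (regate t 1))) (flaw (List.replicate (m - j) t))
            (gate (lconv t.M (ftop (List.replicate j (regate t 1))) t.ρ (gate (flaw (List.replicate j (regate t 1))) (1 / 2))) (2 * t.q)) h
          = ((m : ℝ) + 2) * (t.q * mt) := by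
        rw [sum_mul_lconv _ _ _ _ f1 G1, fmn, sum_mul_gate, sum_mul_lconv _ _ _ _ ρ1 g1, sum_mul_gate, omn, hmean, fmean_replicate,
          fmean_replicate, Nat.cast_sub hjm, hrq, hrm]
        ring
      have d := decAtT_gate_of_sdec _ _ y a z hy0.le ha0 ha1 hay hzy F0 FM F1 Fta hS J
      rw [hCmean] at d
      exact decAtT_mono_top d (by rw [hT0, hT0, hT1, tops_eq t.M m j hjm]; exact Nat.mul_le_mul_right _ (by omega))
    · simp only [comp, if_neg hjm]
      have hP := treeBuiltN_opow t ht' (m + 2)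
      have hA : TreeBuiltN y ((m + 2) * t.n + 1) (ftop (List.replicate (m + 2) (regate t 1)))
          (gate (flaw (List.replicate (m + 2) (regate t 1))) t.q) := TreeBuiltN.gate t.q hq0 hq1 hP
      have hcount : (m + 2) * t.n + 1 < fgates (List.replicate (m + 2) t) := by
        rw [hfg, show (m + 2) * (t.n + 1) = (m + 2) * t.n + (m + 2) by ring]; omega
      have hS := hO y _ _ _ hcount hA
      obtain ⟨_, _, A0, AM, A1, Ata⟩ := hA.lawFacts
      obtain ⟨_, _, o1, omn⟩ := flaw_facts_weak (List.replicate (m + 2) (regate t 1)) (hL1 (m + 2))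
      have hAmean : ∑ h ∈ Finset.range (ftop (List.replicate (m + 2) (regate t 1)) + 1), (h : ℝ) *
          gate (flaw (List.replicate (m + 2) (regate t 1))) t.q h = ((m : ℝ) + 2) * (t.q * mt) := by
        rw [sum_mul_gate, omn, fmean_replicate, hrq, hrm]
        push_cast; ring
      have d := decAtT_gate_of_sdec _ _ y a z hy0.le ha0 ha1 hay hzy A0 AM A1 Ata hS J
      rw [hAmean] at d
      exact decAtT_mono_top d (by rw [hT0, hT1])
  have mix := decAtT_mixture_finset (Finset.range (m + 2)) w (fun j => gate (comp j) a) hw0 hw1 hdec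
  -- the identity
  have eF := flaw_symForest_eq_mix t m (1 / 2) (by norm_num)
  have eF' : flaw (List.replicate (m + 2) t) = fun h => ∑ j ∈ Finset.range (m + 2), w j * comp j h := by
    rw [eF]
    funext h
    conv_rhs => rw [Finset.sum_range_succ]
    have hlastw : w (m + 1) = t.q ^ (m + 1) := by simp only [w, if_neg (show ¬ (m + 1 ≤ m) by omega)]
    have hlastc : comp (m + 1) = gate (flaw (List.replicate (m + 2) (regate t 1))) t.q := by
      simp only [comp, if_neg (show ¬ (m + 1 ≤ m) by omega)]
    have hmid : ∀ j ∈ Finset.range (m + 1), w j * comp j h = (t.q ^ j * (1 - t.q)) *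
        lconv (ftop (List.replicate (m - j) t)) (t.M + ftop (List.replicate j (regate t 1)))
          (flaw (List.replicate (m - j) t))
          (gate (lconv t.M (ftop (List.replicate j (regate t 1))) t.ρ
            (gate (flaw (List.replicate j (regate t 1))) (1 / 2))) (2 * t.q)) h := by
      intro j hj
      rw [Finset.mem_range] at hj
      simp only [w, comp, if_pos (show j ≤ m by omega)]
    rw [hlastw, hlastc, Finset.sum_congr rfl hmid]
  have e : gate (flaw (List.replicate (m + 2) t)) a = fun h => ∑ j ∈ Finset.range (m + 2), w j * gate (comp j) a h := by
    funext h
    rw [eF', gate_fsum_mix _ _ _ _ hw1]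
  -- the mean of the gated forest
  obtain ⟨_, _, _, tmn⟩ := flaw_facts (List.replicate (m + 2) t) hLt
  have hEmean : ∑ h ∈ Finset.range (ftop (List.replicate (m + 2) t) + 1), (h : ℝ) * gate (flaw (List.replicate (m + 2) t)) a h = TE := by
    rw [sum_mul_gate, tmn, fmean_replicate, hTEdef]
    push_cast; ring
  rw [decAt_iff_decAtT, hEmean, e]
  exact mix

end LawDec
end Quant
end Summit.CriticalPhenomena.PercolationContinuityZ3.Theorems
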